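import Summits.CriticalPhenomena.PercolationContinuityZ3.Theorems.PercNearOneGluingNoHeavyQuantFarSunRegions
import Mathlib.Tactic.Linarith
import Mathlib.Tactic.NormNum
import HarnessLib

/-!
# FAR beyond trees: REGION II SLAB BOUNDS for `K = 12` (the θ = 1/4 Chernoff rung, the `1 + 2/hi` start)

builds on p205010 (kernel theorem, internal audit signed; external expert review pending)

Support file (`--supports stmt-CriticalPhenomena-4575`), seat `prim-cert-1` (gen 39); memo `prim-cert-1/FROM-prim-cert-1-g39-VERTEX-GAME.md` §7 (revised).
For `K = 12` the θ = 1/2 ladder of …QuantFarSunRegions is too weak (masses `Σ ≈ 7.5–10`, where the optimal Chernoff parameter is `θ = 2/Σ ≈ 1/4`).  Here: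
`e^{−3/16} ≤ 0.8291` (`HairyCycle.exp_neg_three_sixteenths_le`), the quarter rung **`HairyCycle.one_sub_hairV_le_of_sum_ge_quarter`**
(`n/4 ≤ Σ ⇒ 1 − F ≤ 16·0.8291^n`, from `hairV_univ_ge_of_chernoff` with `θ = 1/4`), the start **`HairyCycle.sum_gt_start_of_R`** (`Σ > 1 + 2/hi` on `R` when
`η < hi`, from `η(Σ − 1) > 2`), and the six slab bounds `slab_12_0 … slab_12_5` for the cells `[19/100,1/4) … [8/25,1/3)` (generated from work/dpc/plan12e.json;
bounds rounded down to 1/1000; they fix the first certified budgets 50, 47, 85, 82, 80, 77 of …CertCells12A/B/C).  Elementary [this work]; no sorries; standard axioms.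
-/

namespace Summit.CriticalPhenomena.PercolationContinuityZ3.Theorems.HairyCycle

open Finset

variable {K : ℕ}

/-! ## The quarter rung and the start -/

/-- `e^{−3/16} ≤ 0.8291` (from `e^{−1} < 0.3678794412`: `0.8291^16 > 0.3678794412^3 > e^{−3}`). [folklore] -/
theorem exp_neg_three_sixteenths_le : Real.exp (-3 / 16) ≤ 8291 / 10000 := by
  by_contra hc
  push Not at hc
  have h16 : (8291 / 10000 : ℝ) ^ 16 < (Real.exp (-3 / 16)) ^ 16 := pow_lt_pow_left₀ hc (by norm_num) (by norm_num)
  rw [← Real.exp_nat_mul] at h16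
  have e3 : Real.exp ((16 : ℕ) * (-3 / 16 : ℝ)) = Real.exp (-1) ^ 3 := by
    rw [← Real.exp_nat_mul]; norm_num
  rw [e3] at h16
  have hd := Real.exp_neg_one_lt_d9
  have h3 : Real.exp (-1) ^ 3 < (0.3678794412 : ℝ) ^ 3 := pow_lt_pow_left₀ hd (Real.exp_pos _).le (by norm_num)
  norm_num at h16 h3
  linarith

/-- **Chernoff rung (θ = 1/4)**: if `n/4 ≤ Σ` then `1 − F ≤ 16 · 0.8291^n` (`h ∈ [0,1]` on `range K`). [this work] -/
theorem one_sub_hairV_le_of_sum_ge_quarter {h : ℕ → ℝ} (hh : ∀ k, k < K → 0 ≤ h k ∧ h k ≤ 1) (n : ℕ)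
    (hn : (n : ℝ) / 4 ≤ ∑ k ∈ range K, h k) : 1 - hairV K h 2 (range K) ≤ 16 * (8291 / 10000 : ℝ) ^ n := by
  have hc := hairV_univ_ge_of_chernoff hh (θ := 1 / 4) (by norm_num) (by norm_num)
  have hexp : Real.exp (-(1 - 1 / 4) * ∑ k ∈ range K, h k) ≤ (8291 / 10000 : ℝ) ^ n := by
    calc Real.exp (-(1 - 1 / 4) * ∑ k ∈ range K, h k) ≤ Real.exp ((n : ℝ) * (-3 / 16)) :=
          Real.exp_le_exp.2 (by linarith)
      _ = (Real.exp (-3 / 16)) ^ n := by rw [Real.exp_nat_mul]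
      _ ≤ (8291 / 10000 : ℝ) ^ n := pow_le_pow_left₀ (Real.exp_pos _).le exp_neg_three_sixteenths_le n
  have h16 : ((1 : ℝ) / 4) ^ 2 = 1 / 16 := by norm_num
  rw [h16] at hc
  linarith [hexp, hc]

/-- **Ladder start**: on `R`, if `η < hi` (`0 < hi`) then `1 + 2/hi < Σ` (from `η(Σ − 1) > 2`). [this work] -/
theorem sum_gt_start_of_R {h : ℕ → ℝ} (hh : ∀ k, 0 ≤ h k ∧ h k ≤ 1) {m : ℕ} (hmin : ∀ k, k < K → h m ≤ h k) {hi : ℝ}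
    (hhi : 0 < hi) (hη : h m < hi) (hS4 : (4 : ℝ) < ∑ k ∈ range K, h k)
    (hR : 2 * (hairV K h 2 (range K) - h m) < h m * (∑ k ∈ range K, h k - 4)) : 1 + 2 / hi < ∑ k ∈ range K, h k := by
  set S := ∑ k ∈ range K, h k with hS
  have h2 := eta_mul_gt_two_of_R hh hmin hS4 hR
  have h3 : h m * (S - 1) ≤ hi * (S - 1) := mul_le_mul_of_nonneg_right hη.le (by linarith)
  have h4 : 2 / hi < S - 1 := by rw [div_lt_iff₀ hhi]; nlinarith
  linarith

/-! ## The slab bounds, `K = 12` -/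

/-- Slab bound `K = 12`, cell `η ∈ [19/100, 1/4)`: on `R`, `η < 1/4` forces `Σ > 9913/1000` (start `1 + 2/hi`, 2 quarter-rung steps; first certified budget 50). [this work] -/
theorem slab_12_0 {h : ℕ → ℝ} (hh : ∀ k, 0 ≤ h k ∧ h k ≤ 1) {m : ℕ} (hmin : ∀ k, k < 12 → h m ≤ h k) (hη : h m < 1 / 4)
    (hS4 : (4 : ℝ) < ∑ k ∈ range 12, h k) (hR : 2 * (hairV 12 h 2 (range 12) - h m) < h m * (∑ k ∈ range 12, h k - 4)) :
    (9913 : ℝ) / 1000 < ∑ k ∈ range 12, h k := by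
  have hh' : ∀ k, k < 12 → 0 ≤ h k ∧ h k ≤ 1 := fun k _ => hh k
  have hhi : (0 : ℝ) < 1 / 4 := by norm_num
  have hT : 1 + 2 / (1 / 4 : ℝ) < ∑ k ∈ range 12, h k := sum_gt_start_of_R hh hmin hhi hη hS4 hR
  have hF0 : 1 - hairV 12 h 2 (range 12) ≤ 16 * (8291 / 10000 : ℝ) ^ 36 :=
    one_sub_hairV_le_of_sum_ge_quarter hh' 36 (by norm_num at hT ⊢; linarith [hT])
  have hT0 : 2 + 2 * ((2453 : ℝ) / 2500) / (1 / 4) < ∑ k ∈ range 12, h k :=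
    sum_gt_of_R_step hhi hη hS4 hR (by norm_num at hF0 ⊢; linarith [hF0])
  have hF1 : 1 - hairV 12 h 2 (range 12) ≤ 16 * (8291 / 10000 : ℝ) ^ 39 :=
    one_sub_hairV_le_of_sum_ge_quarter hh' 39 (by norm_num at hT0 ⊢; linarith [hT0])
  have hT1 : 2 + 2 * ((2473 : ℝ) / 2500) / (1 / 4) < ∑ k ∈ range 12, h k :=
    sum_gt_of_R_step hhi hη hS4 hR (by norm_num at hF1 ⊢; linarith [hF1])
  norm_num at hT1 ⊢
  linarith [hT1]

/-- Slab bound `K = 12`, cell `η ∈ [1/4, 27/100)`: on `R`, `η < 27/100` forces `Σ > 9291/1000` (start `1 + 2/hi`, 3 quarter-rung steps; first certified budget 47). [this work] -/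
theorem slab_12_1 {h : ℕ → ℝ} (hh : ∀ k, 0 ≤ h k ∧ h k ≤ 1) {m : ℕ} (hmin : ∀ k, k < 12 → h m ≤ h k) (hη : h m < 27 / 100)
    (hS4 : (4 : ℝ) < ∑ k ∈ range 12, h k) (hR : 2 * (hairV 12 h 2 (range 12) - h m) < h m * (∑ k ∈ range 12, h k - 4)) :
    (9291 : ℝ) / 1000 < ∑ k ∈ range 12, h k := by
  have hh' : ∀ k, k < 12 → 0 ≤ h k ∧ h k ≤ 1 := fun k _ => hh k
  have hhi : (0 : ℝ) < 27 / 100 := by norm_num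
  have hT : 1 + 2 / (27 / 100 : ℝ) < ∑ k ∈ range 12, h k := sum_gt_start_of_R hh hmin hhi hη hS4 hR
  have hF0 : 1 - hairV 12 h 2 (range 12) ≤ 16 * (8291 / 10000 : ℝ) ^ 33 :=
    one_sub_hairV_le_of_sum_ge_quarter hh' 33 (by norm_num at hT ⊢; linarith [hT])
  have hT0 : 2 + 2 * ((967 : ℝ) / 1000) / (27 / 100) < ∑ k ∈ range 12, h k :=
    sum_gt_of_R_step hhi hη hS4 hR (by norm_num at hF0 ⊢; linarith [hF0])
  have hF1 : 1 - hairV 12 h 2 (range 12) ≤ 16 * (8291 / 10000 : ℝ) ^ 36 :=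
    one_sub_hairV_le_of_sum_ge_quarter hh' 36 (by norm_num at hT0 ⊢; linarith [hT0])
  have hT1 : 2 + 2 * ((2453 : ℝ) / 2500) / (27 / 100) < ∑ k ∈ range 12, h k :=
    sum_gt_of_R_step hhi hη hS4 hR (by norm_num at hF1 ⊢; linarith [hF1])
  have hF2 : 1 - hairV 12 h 2 (range 12) ≤ 16 * (8291 / 10000 : ℝ) ^ 37 :=
    one_sub_hairV_le_of_sum_ge_quarter hh' 37 (by norm_num at hT1 ⊢; linarith [hT1])
  have hT2 : 2 + 2 * ((2461 : ℝ) / 2500) / (27 / 100) < ∑ k ∈ range 12, h k :=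
    sum_gt_of_R_step hhi hη hS4 hR (by norm_num at hF2 ⊢; linarith [hF2])
  norm_num at hT2 ⊢
  linarith [hT2]

/-- Slab bound `K = 12`, cell `η ∈ [27/100, 3/10)`: on `R`, `η < 3/10` forces `Σ > 4223/500` (start `1 + 2/hi`, 2 quarter-rung steps; first certified budget 85). [this work] -/
theorem slab_12_2 {h : ℕ → ℝ} (hh : ∀ k, 0 ≤ h k ∧ h k ≤ 1) {m : ℕ} (hmin : ∀ k, k < 12 → h m ≤ h k) (hη : h m < 3 / 10)
    (hS4 : (4 : ℝ) < ∑ k ∈ range 12, h k) (hR : 2 * (hairV 12 h 2 (range 12) - h m) < h m * (∑ k ∈ range 12, h k - 4)) :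
    (4223 : ℝ) / 500 < ∑ k ∈ range 12, h k := by
  have hh' : ∀ k, k < 12 → 0 ≤ h k ∧ h k ≤ 1 := fun k _ => hh k
  have hhi : (0 : ℝ) < 3 / 10 := by norm_num
  have hT : 1 + 2 / (3 / 10 : ℝ) < ∑ k ∈ range 12, h k := sum_gt_start_of_R hh hmin hhi hη hS4 hR
  have hF0 : 1 - hairV 12 h 2 (range 12) ≤ 16 * (8291 / 10000 : ℝ) ^ 30 :=
    one_sub_hairV_le_of_sum_ge_quarter hh' 30 (by norm_num at hT ⊢; linarith [hT])
  have hT0 : 2 + 2 * ((9421 : ℝ) / 10000) / (3 / 10) < ∑ k ∈ range 12, h k :=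
    sum_gt_of_R_step hhi hη hS4 hR (by norm_num at hF0 ⊢; linarith [hF0])
  have hF1 : 1 - hairV 12 h 2 (range 12) ≤ 16 * (8291 / 10000 : ℝ) ^ 33 :=
    one_sub_hairV_le_of_sum_ge_quarter hh' 33 (by norm_num at hT0 ⊢; linarith [hT0])
  have hT1 : 2 + 2 * ((967 : ℝ) / 1000) / (3 / 10) < ∑ k ∈ range 12, h k :=
    sum_gt_of_R_step hhi hη hS4 hR (by norm_num at hF1 ⊢; linarith [hF1])
  norm_num at hT1 ⊢
  linarith [hT1]

/-- Slab bound `K = 12`, cell `η ∈ [3/10, 31/100)`: on `R`, `η < 31/100` forces `Σ > 4097/500` (start `1 + 2/hi`, 2 quarter-rung steps; first certified budget 82). [this work] -/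
theorem slab_12_3 {h : ℕ → ℝ} (hh : ∀ k, 0 ≤ h k ∧ h k ≤ 1) {m : ℕ} (hmin : ∀ k, k < 12 → h m ≤ h k) (hη : h m < 31 / 100)
    (hS4 : (4 : ℝ) < ∑ k ∈ range 12, h k) (hR : 2 * (hairV 12 h 2 (range 12) - h m) < h m * (∑ k ∈ range 12, h k - 4)) :
    (4097 : ℝ) / 500 < ∑ k ∈ range 12, h k := by
  have hh' : ∀ k, k < 12 → 0 ≤ h k ∧ h k ≤ 1 := fun k _ => hh k
  have hhi : (0 : ℝ) < 31 / 100 := by norm_num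
  have hT : 1 + 2 / (31 / 100 : ℝ) < ∑ k ∈ range 12, h k := sum_gt_start_of_R hh hmin hhi hη hS4 hR
  have hF0 : 1 - hairV 12 h 2 (range 12) ≤ 16 * (8291 / 10000 : ℝ) ^ 29 :=
    one_sub_hairV_le_of_sum_ge_quarter hh' 29 (by norm_num at hT ⊢; linarith [hT])
  have hT0 : 2 + 2 * ((4651 : ℝ) / 5000) / (31 / 100) < ∑ k ∈ range 12, h k :=
    sum_gt_of_R_step hhi hη hS4 hR (by norm_num at hF0 ⊢; linarith [hF0])
  have hF1 : 1 - hairV 12 h 2 (range 12) ≤ 16 * (8291 / 10000 : ℝ) ^ 32 :=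
    one_sub_hairV_le_of_sum_ge_quarter hh' 32 (by norm_num at hT0 ⊢; linarith [hT0])
  have hT1 : 2 + 2 * ((4801 : ℝ) / 5000) / (31 / 100) < ∑ k ∈ range 12, h k :=
    sum_gt_of_R_step hhi hη hS4 hR (by norm_num at hF1 ⊢; linarith [hF1])
  norm_num at hT1 ⊢
  linarith [hT1]

/-- Slab bound `K = 12`, cell `η ∈ [31/100, 8/25)`: on `R`, `η < 8/25` forces `Σ > 159/20` (start `1 + 2/hi`, 2 quarter-rung steps; first certified budget 80). [this work] -/
theorem slab_12_4 {h : ℕ → ℝ} (hh : ∀ k, 0 ≤ h k ∧ h k ≤ 1) {m : ℕ} (hmin : ∀ k, k < 12 → h m ≤ h k) (hη : h m < 8 / 25)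
    (hS4 : (4 : ℝ) < ∑ k ∈ range 12, h k) (hR : 2 * (hairV 12 h 2 (range 12) - h m) < h m * (∑ k ∈ range 12, h k - 4)) :
    (159 : ℝ) / 20 < ∑ k ∈ range 12, h k := by
  have hh' : ∀ k, k < 12 → 0 ≤ h k ∧ h k ≤ 1 := fun k _ => hh k
  have hhi : (0 : ℝ) < 8 / 25 := by norm_num
  have hT : 1 + 2 / (8 / 25 : ℝ) < ∑ k ∈ range 12, h k := sum_gt_start_of_R hh hmin hhi hη hS4 hR
  have hF0 : 1 - hairV 12 h 2 (range 12) ≤ 16 * (8291 / 10000 : ℝ) ^ 29 :=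
    one_sub_hairV_le_of_sum_ge_quarter hh' 29 (by norm_num at hT ⊢; linarith [hT])
  have hT0 : 2 + 2 * ((4651 : ℝ) / 5000) / (8 / 25) < ∑ k ∈ range 12, h k :=
    sum_gt_of_R_step hhi hη hS4 hR (by norm_num at hF0 ⊢; linarith [hF0])
  have hF1 : 1 - hairV 12 h 2 (range 12) ≤ 16 * (8291 / 10000 : ℝ) ^ 31 :=
    one_sub_hairV_le_of_sum_ge_quarter hh' 31 (by norm_num at hT0 ⊢; linarith [hT0])
  have hT1 : 2 + 2 * ((119 : ℝ) / 125) / (8 / 25) < ∑ k ∈ range 12, h k :=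
    sum_gt_of_R_step hhi hη hS4 hR (by norm_num at hF1 ⊢; linarith [hF1])
  norm_num at hT1 ⊢
  linarith [hT1]

/-- Slab bound `K = 12`, cell `η ∈ [8/25, 1/3)`: on `R`, `η < 1/3` forces `Σ > 1913/250` (start `1 + 2/hi`, 3 quarter-rung steps; first certified budget 77). [this work] -/
theorem slab_12_5 {h : ℕ → ℝ} (hh : ∀ k, 0 ≤ h k ∧ h k ≤ 1) {m : ℕ} (hmin : ∀ k, k < 12 → h m ≤ h k) (hη : h m < 1 / 3)
    (hS4 : (4 : ℝ) < ∑ k ∈ range 12, h k) (hR : 2 * (hairV 12 h 2 (range 12) - h m) < h m * (∑ k ∈ range 12, h k - 4)) :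
    (1913 : ℝ) / 250 < ∑ k ∈ range 12, h k := by
  have hh' : ∀ k, k < 12 → 0 ≤ h k ∧ h k ≤ 1 := fun k _ => hh k
  have hhi : (0 : ℝ) < 1 / 3 := by norm_num
  have hT : 1 + 2 / (1 / 3 : ℝ) < ∑ k ∈ range 12, h k := sum_gt_start_of_R hh hmin hhi hη hS4 hR
  have hF0 : 1 - hairV 12 h 2 (range 12) ≤ 16 * (8291 / 10000 : ℝ) ^ 28 :=
    one_sub_hairV_le_of_sum_ge_quarter hh' 28 (by norm_num at hT ⊢; linarith [hT])
  have hT0 : 2 + 2 * ((4579 : ℝ) / 5000) / (1 / 3) < ∑ k ∈ range 12, h k :=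
    sum_gt_of_R_step hhi hη hS4 hR (by norm_num at hF0 ⊢; linarith [hF0])
  have hF1 : 1 - hairV 12 h 2 (range 12) ≤ 16 * (8291 / 10000 : ℝ) ^ 29 :=
    one_sub_hairV_le_of_sum_ge_quarter hh' 29 (by norm_num at hT0 ⊢; linarith [hT0])
  have hT1 : 2 + 2 * ((4651 : ℝ) / 5000) / (1 / 3) < ∑ k ∈ range 12, h k :=
    sum_gt_of_R_step hhi hη hS4 hR (by norm_num at hF1 ⊢; linarith [hF1])
  have hF2 : 1 - hairV 12 h 2 (range 12) ≤ 16 * (8291 / 10000 : ℝ) ^ 30 :=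
    one_sub_hairV_le_of_sum_ge_quarter hh' 30 (by norm_num at hT1 ⊢; linarith [hT1])
  have hT2 : 2 + 2 * ((9421 : ℝ) / 10000) / (1 / 3) < ∑ k ∈ range 12, h k :=
    sum_gt_of_R_step hhi hη hS4 hR (by norm_num at hF2 ⊢; linarith [hF2])
  norm_num at hT2 ⊢
  linarith [hT2]

end Summit.CriticalPhenomena.PercolationContinuityZ3.Theorems.HairyCycle
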